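import Summits.SmoothPoincare4.SmoothPoincare4.Theorems.CongruenceShadowsGriffithsHandlebodyExtensionCoverLiftA
import HarnessLib

/-!
# SmoothPoincare4 / CongruenceShadows — `GriffithsHandlebodyExtension` (item stmt-SmoothPoincare4-15190): lifting the boundary diffeomorphism, II — periods of the lift (E2)

Support file (`--supports` stmt-SmoothPoincare4-15190) of the homothety-cover proof of the genus-one
clause (E) of Griffiths' handlebody extension theorem — *every self-diffeomorphism of the Heegaard torus
`∂V` of the round solid torus fixing the base point and acting trivially on `π₁(∂V)` extends to a
self-diffeomorphism of `V`* (hypothesis `hE` of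
`Literature.Topology.FourManifolds.RoundSolidTorusModel.diffeoExtends_of_map_ker_eq_ker_of_forall_diffeoExtends`).
See the module docstring of `…CoverDefs` for the whole line (E1–E6) and the notation
(`τ̂`, `δ_λ`, `ρ`, `χ`, `f`, `Δ^(c)`, `α`, `L`, `M`, `Ψ̂`, `ẽ_c`).

This part (E2, second half): for a `π₁`-trivial `τV` the lift satisfies `liftT (x + (2π,0)) = liftT x + (2π,0)` and
`liftT (x + (0,2π)) = liftT x + (0,2π)` (from the monodromy computation), and the integer iterates.
-/

-- the registered namespace `Summit.SmoothPoincare4.SmoothPoincare4.Theorems` repeats a component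
set_option linter.dupNamespace false

noncomputable section

namespace Summit.SmoothPoincare4.SmoothPoincare4.Theorems

namespace HomothetyCover

open Set Function Metric Filter
open scoped Topology ContDiff

section Lift

open Literature.Topology.FourManifolds Literature.Topology.FourManifolds.RoundSolidTorusModel
open Complex (I)
open scoped Manifold
variable (τV : (𝓡∂ 3).boundary RoundSolidTorus ≃ₘ⟮𝓡 2, 𝓡 2⟯ (𝓡∂ 3).boundary RoundSolidTorus)
variable {τV}
variable (τV)
variable {τV}

/-- **The four periods at the origin**: `F̃ (2π, 0) = (2π, 0)`. -/
theorem liftT_two_pi_zero (hτ : τV basePt = basePt)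
    (h : ∀ γ, FundamentalGroup.mapOfEq (⟨τV, τV.continuous⟩ : C(_, _)) hτ γ = γ) :
    liftT hτ (2 * Real.pi, 0) = (2 * Real.pi, 0) := by
  have hhom := homotopic_map_angMap hτ h stdLoop₁
  set M := (stdLoop₁.map (angMap τV).continuous).cast (angMap_zero hτ).symm (angMap_zero hτ).symm
    with hM
  have hM_apply : ∀ s, M s = angMap τV (cT ((s : ℝ) * (2 * Real.pi), 0)) := fun s => rfl
  -- first component
  have h1 : (liftT hτ (2 * Real.pi, 0)).1 = 2 * Real.pi := by
    set ℓ : Path (0 : AddCircle (2 * Real.pi)) 0 := M.map continuous_fst with hℓ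
    have hℓhom : ℓ.Homotopic (stdLoop₁.map continuous_fst) := hhom.map ⟨Prod.fst, continuous_fst⟩
    have hstd : stdLoop₁.map continuous_fst = addCircleLoopZ (2 * Real.pi) 1 (0 : AddCircle (2 * Real.pi)) := by
      ext s
      rw [Path.map_coe, Function.comp_apply, stdLoop₁_apply, addCircleLoopZ_apply]
      simp [cT]
    have hclass : Path.Homotopic.Quotient.mk ℓ =
        Path.Homotopic.Quotient.mk (addCircleLoopZ (2 * Real.pi) 1 (0 : AddCircle (2 * Real.pi))) := by
      rw [Path.Homotopic.Quotient.eq, ← hstd]; exact hℓhom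
    set Λ : Path (0 : ℝ) ((liftT hτ (2 * Real.pi, 0)).1) :=
      { toFun := fun s => (liftT hτ ((s : ℝ) * (2 * Real.pi), 0)).1
        continuous_toFun := continuous_fst.comp ((continuous_liftT hτ).comp (by fun_prop))
        source' := by simp [liftT_zero hτ]
        target' := by simp } with hΛ
    obtain ⟨hy, hmono⟩ := monodromy_eq_of_lift ℓ Λ (fun s => by
      show (((liftT hτ ((s : ℝ) * (2 * Real.pi), 0)).1 : ℝ) : AddCircle (2 * Real.pi)) = (M s).1
      rw [coe_liftT_fst, hM_apply])
    have := congrArg (fun e : ((↑) : ℝ → AddCircle (2 * Real.pi)) ⁻¹' {(0 : AddCircle (2 * Real.pi))} => (e : ℝ)) hmono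
    simp only at this
    rw [hclass, monodromy_addCircleLoopZ_one] at this
    exact this.symm
  -- second component
  have h2 : (liftT hτ (2 * Real.pi, 0)).2 = 0 := by
    set ℓ : Path (0 : AddCircle (2 * Real.pi)) 0 := M.map continuous_snd with hℓ
    have hℓhom : ℓ.Homotopic (stdLoop₁.map continuous_snd) := hhom.map ⟨Prod.snd, continuous_snd⟩
    have hstd : stdLoop₁.map continuous_snd = Path.refl (0 : AddCircle (2 * Real.pi)) := by
      ext s
      rw [Path.map_coe, Function.comp_apply, stdLoop₁_apply]
      simp [cT]
    have hclass : Path.Homotopic.Quotient.mk ℓ = Path.Homotopic.Quotient.mk (Path.refl (0 : AddCircle (2 * Real.pi))) := by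
      rw [Path.Homotopic.Quotient.eq, ← hstd]; exact hℓhom
    set Λ : Path (0 : ℝ) ((liftT hτ (2 * Real.pi, 0)).2) :=
      { toFun := fun s => (liftT hτ ((s : ℝ) * (2 * Real.pi), 0)).2
        continuous_toFun := continuous_snd.comp ((continuous_liftT hτ).comp (by fun_prop))
        source' := by simp [liftT_zero hτ]
        target' := by simp } with hΛ
    obtain ⟨hy, hmono⟩ := monodromy_eq_of_lift ℓ Λ (fun s => by
      show (((liftT hτ ((s : ℝ) * (2 * Real.pi), 0)).2 : ℝ) : AddCircle (2 * Real.pi)) = (M s).2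
      rw [coe_liftT_snd, hM_apply])
    have := congrArg (fun e : ((↑) : ℝ → AddCircle (2 * Real.pi)) ⁻¹' {(0 : AddCircle (2 * Real.pi))} => (e : ℝ)) hmono
    simp only at this
    rw [hclass, Path.Homotopic.Quotient.mk_refl, isCoveringMap_angle.monodromy_refl] at this
    simp only [id_eq, fib0] at this
    exact this.symm
  exact Prod.ext h1 h2

/-- `F̃ (0, 2π) = (0, 2π)`. -/
theorem liftT_zero_two_pi (hτ : τV basePt = basePt)
    (h : ∀ γ, FundamentalGroup.mapOfEq (⟨τV, τV.continuous⟩ : C(_, _)) hτ γ = γ) :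
    liftT hτ (0, 2 * Real.pi) = (0, 2 * Real.pi) := by
  have hhom := homotopic_map_angMap hτ h stdLoop₂
  set M := (stdLoop₂.map (angMap τV).continuous).cast (angMap_zero hτ).symm (angMap_zero hτ).symm
    with hM
  have hM_apply : ∀ s, M s = angMap τV (cT (0, (s : ℝ) * (2 * Real.pi))) := fun s => rfl
  -- first component
  have h1 : (liftT hτ (0, 2 * Real.pi)).1 = 0 := by
    set ℓ : Path (0 : AddCircle (2 * Real.pi)) 0 := M.map continuous_fst with hℓ
    have hℓhom : ℓ.Homotopic (stdLoop₂.map continuous_fst) := hhom.map ⟨Prod.fst, continuous_fst⟩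
    have hstd : stdLoop₂.map continuous_fst = Path.refl (0 : AddCircle (2 * Real.pi)) := by
      ext s
      rw [Path.map_coe, Function.comp_apply, stdLoop₂_apply]
      simp [cT]
    have hclass : Path.Homotopic.Quotient.mk ℓ = Path.Homotopic.Quotient.mk (Path.refl (0 : AddCircle (2 * Real.pi))) := by
      rw [Path.Homotopic.Quotient.eq, ← hstd]; exact hℓhom
    set Λ : Path (0 : ℝ) ((liftT hτ (0, 2 * Real.pi)).1) :=
      { toFun := fun s => (liftT hτ (0, (s : ℝ) * (2 * Real.pi))).1
        continuous_toFun := continuous_fst.comp ((continuous_liftT hτ).comp (by fun_prop))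
        source' := by simp [liftT_zero hτ]
        target' := by simp } with hΛ
    obtain ⟨hy, hmono⟩ := monodromy_eq_of_lift ℓ Λ (fun s => by
      show (((liftT hτ (0, (s : ℝ) * (2 * Real.pi))).1 : ℝ) : AddCircle (2 * Real.pi)) = (M s).1
      rw [coe_liftT_fst, hM_apply])
    have := congrArg (fun e : ((↑) : ℝ → AddCircle (2 * Real.pi)) ⁻¹' {(0 : AddCircle (2 * Real.pi))} => (e : ℝ)) hmono
    simp only at this
    rw [hclass, Path.Homotopic.Quotient.mk_refl, isCoveringMap_angle.monodromy_refl] at this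
    simp only [id_eq, fib0] at this
    exact this.symm
  -- second component
  have h2 : (liftT hτ (0, 2 * Real.pi)).2 = 2 * Real.pi := by
    set ℓ : Path (0 : AddCircle (2 * Real.pi)) 0 := M.map continuous_snd with hℓ
    have hℓhom : ℓ.Homotopic (stdLoop₂.map continuous_snd) := hhom.map ⟨Prod.snd, continuous_snd⟩
    have hstd : stdLoop₂.map continuous_snd = addCircleLoopZ (2 * Real.pi) 1 (0 : AddCircle (2 * Real.pi)) := by
      ext s
      rw [Path.map_coe, Function.comp_apply, stdLoop₂_apply, addCircleLoopZ_apply]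
      simp [cT]
    have hclass : Path.Homotopic.Quotient.mk ℓ =
        Path.Homotopic.Quotient.mk (addCircleLoopZ (2 * Real.pi) 1 (0 : AddCircle (2 * Real.pi))) := by
      rw [Path.Homotopic.Quotient.eq, ← hstd]; exact hℓhom
    set Λ : Path (0 : ℝ) ((liftT hτ (0, 2 * Real.pi)).2) :=
      { toFun := fun s => (liftT hτ (0, (s : ℝ) * (2 * Real.pi))).2
        continuous_toFun := continuous_snd.comp ((continuous_liftT hτ).comp (by fun_prop))
        source' := by simp [liftT_zero hτ]
        target' := by simp } with hΛ
    obtain ⟨hy, hmono⟩ := monodromy_eq_of_lift ℓ Λ (fun s => by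
      show (((liftT hτ (0, (s : ℝ) * (2 * Real.pi))).2 : ℝ) : AddCircle (2 * Real.pi)) = (M s).2
      rw [coe_liftT_snd, hM_apply])
    have := congrArg (fun e : ((↑) : ℝ → AddCircle (2 * Real.pi)) ⁻¹' {(0 : AddCircle (2 * Real.pi))} => (e : ℝ)) hmono
    simp only at this
    rw [hclass, monodromy_addCircleLoopZ_one] at this
    exact this.symm
  exact Prod.ext h1 h2

/-- `cT` is `2π`-periodic in the first variable (subtractive form). -/
theorem cT_sub_two_pi_left (x : ℝ × ℝ) : cT (x - (2 * Real.pi, 0)) = cT x := by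
  simp [cT]

/-- `cT` is `2π`-periodic in the second variable (subtractive form). -/
theorem cT_sub_two_pi_right (x : ℝ × ℝ) : cT (x - (0, 2 * Real.pi)) = cT x := by
  simp [cT]

/-- **Equivariance in the longitude direction**: `F̃ (x + (2π, 0)) = F̃ x + (2π, 0)`. -/
theorem liftT_add_left (hτ : τV basePt = basePt)
    (h : ∀ γ, FundamentalGroup.mapOfEq (⟨τV, τV.continuous⟩ : C(_, _)) hτ γ = γ) (x : ℝ × ℝ) :
    liftT hτ (x + (2 * Real.pi, 0)) = liftT hτ x + (2 * Real.pi, 0) := by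
  have key : (fun x => liftT hτ (x + (2 * Real.pi, 0)) - (2 * Real.pi, 0)) = liftT hτ := by
    refine liftT_unique hτ (((continuous_liftT hτ).comp (continuous_id.add continuous_const)).sub
      continuous_const) (fun x => ?_) (x₀ := (0, 0)) ?_
    · rw [cT_sub_two_pi_left, cT_liftT, cT_add_two_pi_left]
    · rw [Prod.mk_add_mk, zero_add, add_zero, liftT_two_pi_zero hτ h, Prod.mk_sub_mk, sub_self, sub_self,
        liftT_zero hτ]
  have := congrFun key x
  rw [← this, sub_add_cancel]

/-- **Equivariance in the meridian direction**: `F̃ (x + (0, 2π)) = F̃ x + (0, 2π)`. -/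
theorem liftT_add_right (hτ : τV basePt = basePt)
    (h : ∀ γ, FundamentalGroup.mapOfEq (⟨τV, τV.continuous⟩ : C(_, _)) hτ γ = γ) (x : ℝ × ℝ) :
    liftT hτ (x + (0, 2 * Real.pi)) = liftT hτ x + (0, 2 * Real.pi) := by
  have key : (fun x => liftT hτ (x + (0, 2 * Real.pi)) - (0, 2 * Real.pi)) = liftT hτ := by
    refine liftT_unique hτ (((continuous_liftT hτ).comp (continuous_id.add continuous_const)).sub
      continuous_const) (fun x => ?_) (x₀ := (0, 0)) ?_
    · rw [cT_sub_two_pi_right, cT_liftT, cT_add_two_pi_right]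
    · rw [Prod.mk_add_mk, zero_add, zero_add, liftT_zero_two_pi hτ h, Prod.mk_sub_mk, sub_self, sub_self,
        liftT_zero hτ]
  have := congrFun key x
  rw [← this, sub_add_cancel]

/-- Integer iterates: `F̃ (x + (2πm, 0)) = F̃ x + (2πm, 0)`. -/
theorem liftT_add_left_int (hτ : τV basePt = basePt)
    (h : ∀ γ, FundamentalGroup.mapOfEq (⟨τV, τV.continuous⟩ : C(_, _)) hτ γ = γ) (m : ℤ) (x : ℝ × ℝ) :
    liftT hτ (x + (2 * Real.pi * m, 0)) = liftT hτ x + (2 * Real.pi * m, 0) := by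
  induction m generalizing x with
  | zero => simp [Prod.mk_zero_zero]
  | succ n ih =>
    have e : ((2 * Real.pi * ((n : ℤ) + 1 : ℤ) : ℝ), (0 : ℝ)) =
        ((2 * Real.pi * ((n : ℤ) : ℝ), (0 : ℝ)) : ℝ × ℝ) + (2 * Real.pi, 0) := by
      exact Prod.ext (by simp only [Prod.fst_add]; push_cast; ring)
        (by simp only [Prod.snd_add]; ring)
    rw [e, ← add_assoc, liftT_add_left hτ h, ih, add_assoc]
  | pred n ih =>
    have e : x + ((2 * Real.pi * ((-(n : ℤ) - 1 : ℤ)) : ℝ), (0 : ℝ)) =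
        (x + (2 * Real.pi * ((-(n : ℤ) : ℤ) : ℝ), 0)) - (2 * Real.pi, 0) := by
      exact Prod.ext (by simp only [Prod.fst_add, Prod.fst_sub]; push_cast; ring)
        (by simp only [Prod.snd_add, Prod.snd_sub]; ring)
    have e2 : ((2 * Real.pi * ((-(n : ℤ) - 1 : ℤ)) : ℝ), (0 : ℝ)) =
        ((2 * Real.pi * ((-(n : ℤ) : ℤ) : ℝ), 0) : ℝ × ℝ) - (2 * Real.pi, 0) := by
      exact Prod.ext (by simp only [Prod.fst_sub]; push_cast; ring)
        (by simp only [Prod.snd_sub]; ring)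
    have h3 := liftT_add_left hτ h ((x + (2 * Real.pi * ((-(n : ℤ) : ℤ) : ℝ), 0)) - (2 * Real.pi, 0))
    rw [sub_add_cancel, ih] at h3
    rw [e, e2, ← add_sub_assoc, eq_sub_iff_add_eq]
    exact h3.symm

/-- Integer iterates: `F̃ (x + (0, 2πk)) = F̃ x + (0, 2πk)`. -/
theorem liftT_add_right_int (hτ : τV basePt = basePt)
    (h : ∀ γ, FundamentalGroup.mapOfEq (⟨τV, τV.continuous⟩ : C(_, _)) hτ γ = γ) (k : ℤ) (x : ℝ × ℝ) :
    liftT hτ (x + (0, 2 * Real.pi * k)) = liftT hτ x + (0, 2 * Real.pi * k) := by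
  induction k generalizing x with
  | zero => simp [Prod.mk_zero_zero]
  | succ n ih =>
    have e : ((0 : ℝ), (2 * Real.pi * ((n : ℤ) + 1 : ℤ) : ℝ)) =
        (((0 : ℝ), 2 * Real.pi * ((n : ℤ) : ℝ)) : ℝ × ℝ) + (0, 2 * Real.pi) := by
      exact Prod.ext (by simp only [Prod.fst_add]; ring)
        (by simp only [Prod.snd_add]; push_cast; ring)
    rw [e, ← add_assoc, liftT_add_right hτ h, ih, add_assoc]
  | pred n ih =>
    have e : x + ((0 : ℝ), (2 * Real.pi * ((-(n : ℤ) - 1 : ℤ)) : ℝ)) =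
        (x + (0, 2 * Real.pi * ((-(n : ℤ) : ℤ) : ℝ))) - (0, 2 * Real.pi) := by
      exact Prod.ext (by simp only [Prod.fst_add, Prod.fst_sub]; ring)
        (by simp only [Prod.snd_add, Prod.snd_sub]; push_cast; ring)
    have e2 : ((0 : ℝ), (2 * Real.pi * ((-(n : ℤ) - 1 : ℤ)) : ℝ)) =
        ((0, 2 * Real.pi * ((-(n : ℤ) : ℤ) : ℝ)) : ℝ × ℝ) - (0, 2 * Real.pi) := by
      exact Prod.ext (by simp only [Prod.fst_sub]; ring)
        (by simp only [Prod.snd_sub]; push_cast; ring)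
    have h3 := liftT_add_right hτ h ((x + (0, 2 * Real.pi * ((-(n : ℤ) : ℤ) : ℝ))) - (0, 2 * Real.pi))
    rw [sub_add_cancel, ih] at h3
    rw [e, e2, ← add_sub_assoc, eq_sub_iff_add_eq]
    exact h3.symm

end Lift

end HomothetyCover

end Summit.SmoothPoincare4.SmoothPoincare4.Theorems

end
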